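import Literature.Computability.Complexity.RandomizingPolynomialsGenericBlock
import Literature.Computability.Complexity.DegreeThreeEncodingPerfect
import Literature.Computability.Complexity.BinaryDecisionDiagrams
import HarnessLib

/-!
# Randomizing polynomials XI: the degree-3 perfect encoding of a deterministic branching program

The Ishai–Kushilevitz / Applebaum–Ishai–Kushilevitz construction [AIK 2006, §4.3, Facts 4.13–4.14,
Lemma 4.15; IK 2002, §3] for the tree's deterministic branching programs `BDD X s`
(`BinaryDecisionDiagrams.lean`: nodes `Fin s` in topological order, decision nodes
`branch x lo hi`, sinks `leaf b`, computed function `B.fn : (X → Bool) → Bool`):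

* `bpMat B z : Mat s` — the matrix `L(z)` of AIK Fact 4.13 over `F₂` for the `s + 2`-vertex graph
  "source → root, node → its `z`-successor (edge labels `z x` / `1 + z x`), true sinks → accept":
  adjacency matrix minus identity with the source column and the accept row deleted, rows
  `0 = source, r ↦ node s - r`, columns `c ↦ node s - 1 - c, s = accept`.  It has
  branching-program shape (`isBPShape_bpMat`, file IX) and its corner value IS the computed bit:
  `corner_bpMat : δ(L(z)) = [B.fn z]` — proved with the path-count potential
  (`pot`, `bpMat_mulVec_pot_*`; file IX `corner_eq_of_mulVec`) instead of determinants.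
* `symBP B var` — the same matrix as SPARSE AFFINE POLYNOMIALS in the input variables, numbered by
  `var : X → ℕ` (`evalP_symBP`); `encodeBDD n₀ B var = gBlock n₀ s (symBP B var)` — the
  `(s + 1)(s + 2)/2` entries on and above the diagonal of `R₁ · L · R₂` with `pos s s = s(s+3)/2`
  fresh variables from `n₀` (file X).
* `perfExt_encodeBDD` — **AIK Lemma 4.15**: if all input variables are below `n₀`, `encodeBDD n₀ B var`
  is a perfect extension (file IV's `PerfExt`, i.e. a perfect randomized encoding with blowup
  `2^{pos s s}` at valuation level) of `v ↦ B.fn (inputOf var v)`; `mem_encodeBDD` — every output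
  monomial has length `≤ 3` (DEGREE 3) with variables among the inputs or the fresh block.
* `encodeBDDs var n Bs` / `perfExt_encodeBDDs` / `mem_encodeBDDs` — several programs (the output
  bits of a multi-output function, AIK Lemma 4.9) encoded with consecutive fresh blocks.

Not here: the passage to `PolyMapF2` / `IsPerfectRandomizedEncoding` / output entropy (file
`Literature/Computability/Cryptography/BranchingProgramEncoding.lean`), mod-2 (counting /
nondeterministic) branching programs (AIK's generality — TODO(general form): the same matrix
argument applies verbatim to any acyclic edge-labelled graph), polynomial-time computability of
`B ↦ encodeBDD` (cf. files VII–VIII for `encodeMap`).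

## References

* B. Applebaum, Y. Ishai, E. Kushilevitz, *Cryptography in NC⁰*, SIAM J. Comput. 36 (2006), §4.3:
  Fact 4.13 (`f(x) = det L(x)`), Fact 4.14 (canonical form), Lemma 4.15 (perfect encoding),
  Lemma 4.9 (concatenation).
* Y. Ishai, E. Kushilevitz, ICALP 2002, §3.
-/

namespace Literature.Computability.Complexity

namespace RandPoly

open Matrix Finset

/-! ### Bits and inputs -/

/-- A Boolean as an element of `F₂`. [folklore] -/
def bit (b : Bool) : ZMod 2 := if b then 1 else 0

/-- `bit` is injective. [folklore] -/
theorem bit_injective : Function.Injective bit := by decide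

/-- The input assignment read off a valuation through a variable numbering `var`. [folklore] -/
def inputOf {X : Type*} (var : X → ℕ) (v : ℕ → ZMod 2) : X → Bool := fun x => decide (v (var x) = 1)

/-- Reading a bit back gives the value of the valuation. [folklore] -/
theorem bit_inputOf {X : Type*} (var : X → ℕ) (v : ℕ → ZMod 2) (x : X) :
    bit (inputOf var v x) = v (var x) := by
  unfold bit inputOf
  generalize v (var x) = a
  revert a
  decide

/-- Valuations agreeing on the input variables read the same input. [folklore] -/
theorem inputOf_congr {X : Type*} {var : X → ℕ} {n₀ : ℕ} (hvar : ∀ x, var x < n₀) {v w : ℕ → ZMod 2}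
    (hvw : AgreeBelow n₀ v w) : inputOf var v = inputOf var w := by
  funext x
  simp only [inputOf, hvw (var x) (hvar x)]

/-! ### The matrix of a BDD -/

variable {X : Type*} {s : ℕ}

/-- Out-edges of a node as a row of `L(z)`: a true sink points to the accept column `s`; a decision
node `branch x lo hi` points to the column of `hi` with label `z x` and to the column of `lo` with
label `1 + z x` (column of node `j` is `s - 1 - j`). [cite: ApplebaumIshaiKushilevitz2006, Fact 4.13] -/
def nodeVal (z : X → Bool) (nd : BDD.Node X s) (c : Fin (s + 1)) : ZMod 2 :=
  match nd with
  | .leaf b => if c = Fin.last s ∧ b = true then 1 else 0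
  | .branch x lo hi =>
      (if c.val + 1 + hi.val = s then bit (z x) else 0) +
        (if c.val + 1 + lo.val = s then 1 + bit (z x) else 0)

/-- The adjacency part of `L(z)`: row `0` is the source (one edge to the root, label `1`), row
`r ≥ 1` is node `s - r`. [cite: ApplebaumIshaiKushilevitz2006, Fact 4.13] -/
def edgeVal (B : BDD X s) (z : X → Bool) (r c : Fin (s + 1)) : ZMod 2 :=
  if hr : r.val = 0 then (if c.val + 1 + B.root.val = s then 1 else 0)
  else nodeVal z (B.node ⟨s - r.val, by omega⟩) c

/-- **The matrix `L(z)` of a BDD** (adjacency minus identity, source column and accept row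
deleted; over `F₂` the `-1`'s are `1`'s). [cite: ApplebaumIshaiKushilevitz2006, Fact 4.13] -/
def bpMat (B : BDD X s) (z : X → Bool) : Mat s :=
  Matrix.of fun r c : Fin (s + 1) => edgeVal B z r c + (if r.val = c.val + 1 then 1 else 0)

/-- Out-edges of a node go to LATER columns than the node's own subdiagonal position. [folklore] -/
theorem nodeVal_eq_zero (B : BDD X s) (z : X → Bool) {r c : Fin (s + 1)}
    (hrc : c.val + 1 ≤ r.val) : nodeVal z (B.node ⟨s - r.val, by omega⟩) c = 0 := by
  match hnode : B.node ⟨s - r.val, by omega⟩ with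
  | .leaf b =>
    simp only [nodeVal]
    rw [if_neg]
    rintro ⟨hc, -⟩
    rw [Fin.ext_iff, Fin.val_last] at hc
    omega
  | .branch x lo hi =>
    have hlo := B.lo_lt_of_node_branch hnode
    have hhi := B.hi_lt_of_node_branch hnode
    rw [Fin.lt_def] at hlo hhi
    simp only at hlo hhi
    simp only [nodeVal]
    rw [if_neg (by omega), if_neg (by omega), add_zero]

/-- **`L(z)` has branching-program shape.** [cite: ApplebaumIshaiKushilevitz2006, §4.3] -/
theorem isBPShape_bpMat (B : BDD X s) (z : X → Bool) : IsBPShape (bpMat B z) := by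
  refine ⟨fun r c hrc => ?_, fun r c hrc => ?_⟩
  · simp only [bpMat, of_apply, if_pos hrc, edgeVal, dif_neg (show r.val ≠ 0 by omega)]
    rw [nodeVal_eq_zero B z (by omega), zero_add]
  · simp only [bpMat, of_apply, if_neg (show ¬ r.val = c.val + 1 by omega), add_zero, edgeVal,
      dif_neg (show r.val ≠ 0 by omega)]
    exact nodeVal_eq_zero B z (by omega)

/-! ### The path-count potential and the corner value -/

/-- The potential: column of node `j` ↦ `[B.eval z j]` (does the `z`-path from `j` accept?), accept
column ↦ `1`. [cite: ApplebaumIshaiKushilevitz2006, Fact 4.13 (proof)] -/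
def pot (B : BDD X s) (z : X → Bool) : Fin (s + 1) → ZMod 2 := fun c =>
  if h : c.val < s then bit (B.eval z ⟨s - 1 - c.val, by omega⟩) else 1

/-- The potential at the accept column. [folklore] -/
theorem pot_last (B : BDD X s) (z : X → Bool) : pot B z (Fin.last s) = 1 := by
  simp [pot]

/-- The potential at the column of a node. [folklore] -/
theorem pot_col (B : BDD X s) (z : X → Bool) (j : Fin s) :
    pot B z ⟨s - 1 - j.val, by omega⟩ = bit (B.eval z j) := by
  simp only [pot]
  rw [dif_pos (by omega)]
  congr 2
  ext
  simp only
  omega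

/-- A selector sum over the columns. [folklore] -/
theorem sum_col_select (j : Fin s) (a : ZMod 2) (g : Fin (s + 1) → ZMod 2) :
    (∑ c : Fin (s + 1), (if c.val + 1 + j.val = s then a else 0) * g c) =
      a * g ⟨s - 1 - j.val, by omega⟩ := by
  rw [Finset.sum_eq_single (⟨s - 1 - j.val, by omega⟩ : Fin (s + 1))]
  · rw [if_pos (by simp; omega)]
  · intro c _ hc
    rw [if_neg, zero_mul]
    intro h
    exact hc (Fin.ext (by simp; omega))
  · simp

/-- Row `0` of `L(z) · p`: the source sees the root, `[B.fn z]`. [cite: ApplebaumIshaiKushilevitz2006, Fact 4.13] -/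
theorem bpMat_mulVec_pot_zero (B : BDD X s) (z : X → Bool) :
    (bpMat B z *ᵥ pot B z) 0 = bit (B.fn z) := by
  simp only [Matrix.mulVec, dotProduct]
  have hrow : ∀ c : Fin (s + 1), bpMat B z 0 c = if c.val + 1 + B.root.val = s then 1 else 0 :=
    fun c => by
    rw [bpMat, of_apply, edgeVal, dif_pos (show (0 : Fin (s + 1)).val = 0 from rfl),
      if_neg (show ¬ ((0 : Fin (s + 1)).val = c.val + 1) by simp), add_zero]
  rw [Finset.sum_congr rfl fun c _ => by rw [hrow c], sum_col_select, one_mul, pot_col]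
  rfl

/-- Rows `r ≥ 1` of `L(z) · p` vanish: the value at a node is the value at its `z`-successor
(and a true sink is worth the accept column). [cite: ApplebaumIshaiKushilevitz2006, Fact 4.13] -/
theorem bpMat_mulVec_pot_of_ne_zero (B : BDD X s) (z : X → Bool) {r : Fin (s + 1)} (hr : r.val ≠ 0) :
    (bpMat B z *ᵥ pot B z) r = 0 := by
  simp only [Matrix.mulVec, dotProduct, bpMat, of_apply, add_mul, Finset.sum_add_distrib]
  have hI : ∑ c : Fin (s + 1), (if r.val = c.val + 1 then (1 : ZMod 2) else 0) * pot B z c =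
      bit (B.eval z ⟨s - r.val, by omega⟩) := by
    rw [Finset.sum_eq_single (⟨r.val - 1, by omega⟩ : Fin (s + 1))]
    · rw [if_pos (by simp; omega), one_mul, pot, dif_pos (by simp; omega)]
      congr 2
      ext
      simp only
      omega
    · intro c _ hc
      rw [if_neg, zero_mul]
      intro h
      exact hc (Fin.ext (by simp; omega))
    · simp
  rw [hI]
  simp only [edgeVal, dif_neg hr]
  match hnode : B.node ⟨s - r.val, by omega⟩ with
  | .leaf b =>
    simp only [nodeVal]
    rw [Finset.sum_eq_single (Fin.last s), BDD.eval_of_leaf hnode, pot_last, mul_one]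
    · cases b
      · simp [bit]
      · rw [if_pos ⟨rfl, rfl⟩]
        decide
    · intro c _ hc
      rw [if_neg (fun h => hc h.1), zero_mul]
    · simp
  | .branch x lo hi =>
    simp only [nodeVal, add_mul, Finset.sum_add_distrib]
    rw [sum_col_select, sum_col_select, pot_col, pot_col, BDD.eval_of_branch hnode]
    cases z x <;> cases B.eval z hi <;> cases B.eval z lo <;> decide

/-- **The corner value of `L(z)` is the computed bit**: `δ(L(z)) = [B.fn z]` (AIK: `det L(x) =
f(x)`). [cite: ApplebaumIshaiKushilevitz2006, Fact 4.13] -/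
theorem corner_bpMat (B : BDD X s) (z : X → Bool) : corner (bpMat B z) = bit (B.fn z) :=
  corner_eq_of_mulVec (isBPShape_bpMat B z) (pot_last B z) (bpMat_mulVec_pot_zero B z)
    fun i => bpMat_mulVec_pot_of_ne_zero B z (r := i.succ) (by simp)

/-! ### The symbolic matrix -/

/-- Out-edges of a node as sparse affine polynomials in the input variables (numbered by `var`).
[cite: ApplebaumIshaiKushilevitz2006, Lemma 4.15] -/
def symNode (var : X → ℕ) (nd : BDD.Node X s) (c : ℕ) : List (List ℕ) :=
  match nd with
  | .leaf b => if c = s ∧ b = true then [[]] else []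
  | .branch x lo hi =>
      (if c + 1 + hi.val = s then [[var x]] else []) ++ (if c + 1 + lo.val = s then [[], [var x]] else [])

/-- **The symbolic matrix `L` of a BDD**: entry `(r, c)` as a sparse affine polynomial.
[cite: ApplebaumIshaiKushilevitz2006, Lemma 4.15] -/
def symBP (B : BDD X s) (var : X → ℕ) (r c : ℕ) : List (List ℕ) :=
  (if r = 0 then (if c + 1 + B.root.val = s then [[]] else [])
    else if hr : r ≤ s ∧ 0 < r then symNode var (B.node ⟨s - r, by omega⟩) c else []) ++
    (if r = c + 1 then [[]] else [])

variable {v w : ℕ → ZMod 2}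

/-- Value of a symbolic node row. [folklore] -/
theorem evalP_symNode (var : X → ℕ) (nd : BDD.Node X s) (c : Fin (s + 1)) :
    evalP v (symNode var nd c.val) = nodeVal (inputOf var v) nd c := by
  cases nd with
  | leaf b =>
    simp only [symNode, nodeVal]
    have hc : (c.val = s) ↔ (c = Fin.last s) := by rw [Fin.ext_iff, Fin.val_last]
    simp only [hc]
    split_ifs <;> simp [evalP]
  | branch x lo hi =>
    simp only [symNode, nodeVal, evalP_append]
    congr 1
    · split_ifs <;> simp [evalP, bit_inputOf]
    · split_ifs <;> simp [evalP, bit_inputOf]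

/-- **The symbolic matrix evaluates to `L(z)`** at the input read off the valuation.
[cite: ApplebaumIshaiKushilevitz2006, Lemma 4.15] -/
theorem evalP_symBP (B : BDD X s) (var : X → ℕ) (v : ℕ → ZMod 2) (r c : Fin (s + 1)) :
    evalP v (symBP B var r.val c.val) = bpMat B (inputOf var v) r c := by
  simp only [symBP, bpMat, of_apply, evalP_append, edgeVal]
  congr 1
  · by_cases hr : r.val = 0
    · simp only [hr, if_true, dif_pos]
      split_ifs <;> simp [evalP]
    · rw [if_neg hr, dif_neg hr, dif_pos ⟨by omega, Nat.pos_of_ne_zero hr⟩, evalP_symNode]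
  · split_ifs <;> simp [evalP]

/-- Monomials of the symbolic matrix: affine in the input variables. [folklore] -/
theorem mem_symBP (B : BDD X s) (var : X → ℕ) (r c : ℕ) {μ : List ℕ} (h : μ ∈ symBP B var r c) :
    μ.length ≤ 1 ∧ ∀ y ∈ μ, ∃ x, var x = y := by
  simp only [symBP, List.mem_append] at h
  rcases h with h | h
  · split_ifs at h with h1 h2 h3
    · simp only [List.mem_singleton] at h; subst h; simp
    · simp at h
    · cases hnd : B.node ⟨s - r, by omega⟩ with
      | leaf b =>
        rw [hnd] at h
        simp only [symNode] at h
        split_ifs at h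
        · simp only [List.mem_singleton] at h; subst h; simp
        · simp at h
      | branch x lo hi =>
        rw [hnd] at h
        simp only [symNode, List.mem_append] at h
        rcases h with h | h
        · split_ifs at h
          · simp only [List.mem_singleton] at h; subst h; simp
          · simp at h
        · split_ifs at h
          · simp only [List.mem_cons, List.not_mem_nil, or_false] at h
            rcases h with rfl | rfl <;> simp
          · simp at h
    · simp at h
  · split_ifs at h
    · simp only [List.mem_singleton] at h; subst h; simp
    · simp at h

/-! ### The encoding of one BDD -/

/-- **The degree-3 encoding of a BDD** with fresh variables from `n₀`: the entries on and above the
diagonal of `R₁ · L · R₂`. [cite: ApplebaumIshaiKushilevitz2006, Lemma 4.15] -/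
def encodeBDD (n₀ : ℕ) (B : BDD X s) (var : X → ℕ) : List (List (List ℕ)) :=
  gBlock n₀ s (symBP B var)

/-- The encoding has `(s + 1)(s + 2)/2` outputs. [folklore] -/
theorem length_encodeBDD (n₀ : ℕ) (B : BDD X s) (var : X → ℕ) :
    (encodeBDD n₀ B var).length = (pairsLE s).length :=
  length_gBlock _ _ _

/-- **AIK Lemma 4.15 (valuation level): the encoding of a BDD is a perfect extension of the
computed bit** — injective on the fresh variables `[n₀, n₀ + pos s s)`, decodable, range depending
only on `B.fn`. [cite: ApplebaumIshaiKushilevitz2006, Lemma 4.15] -/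
theorem perfExt_encodeBDD {n₀ : ℕ} (B : BDD X s) {var : X → ℕ} (hvar : ∀ x, var x < n₀) :
    PerfExt n₀ (n₀ + pos s s) (encodeBDD n₀ B var) (fun v => B.fn (inputOf var v)) := by
  have h := perfExt_gBlock n₀ (symX := symBP B var) (X := fun v => bpMat B (inputOf var v))
    (evalP_symBP B var) (fun v => isBPShape_bpMat B _)
    (fun v w hvw => by simp only [inputOf_congr hvar hvw])
  refine h.congr_target fun v w => ?_
  simp only [corner_bpMat]
  exact bit_injective.eq_iff

/-- **Degree `3` and support**: every output monomial of the encoding has length `≤ 3` and its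
variables are input variables or fresh variables in `[n₀, n₀ + pos s s)`.
[cite: ApplebaumIshaiKushilevitz2006, Lemma 4.15] -/
theorem mem_encodeBDD {n₀ : ℕ} {B : BDD X s} {var : X → ℕ} {q : List (List ℕ)}
    (hq : q ∈ encodeBDD n₀ B var) {μ : List ℕ} (hμ : μ ∈ q) :
    μ.length ≤ 3 ∧ ∀ y ∈ μ, (∃ x, var x = y) ∨ (n₀ ≤ y ∧ y < n₀ + pos s s) :=
  mem_gBlock (fun j l _ hν => mem_symBP B var j l hν) hq hμ

/-! ### Several BDDs with consecutive fresh blocks -/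

/-- **Encoding of a list of BDDs** (the output bits of a multi-output function), each with its own
fresh block, consecutively from `n`; returns the final counter and the outputs.
[cite: ApplebaumIshaiKushilevitz2006, Lemma 4.9] -/
def encodeBDDs (var : X → ℕ) : ℕ → List (Σ s, BDD X s) → ℕ × List (List (List ℕ))
  | n, [] => (n, [])
  | n, B :: Bs => ((encodeBDDs var (n + pos B.1 B.1) Bs).1,
      encodeBDD n B.2 var ++ (encodeBDDs var (n + pos B.1 B.1) Bs).2)

/-- The counter does not decrease. [folklore] -/
theorem le_encodeBDDs_fst (var : X → ℕ) (n : ℕ) (Bs : List (Σ s, BDD X s)) :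
    n ≤ (encodeBDDs var n Bs).1 := by
  induction Bs generalizing n with
  | nil => exact le_rfl
  | cons B Bs ih => exact le_trans (Nat.le_add_right _ _) (ih _)

/-- The counter: `n` plus the sizes of the fresh blocks. [folklore] -/
theorem encodeBDDs_fst (var : X → ℕ) (n : ℕ) (Bs : List (Σ s, BDD X s)) :
    (encodeBDDs var n Bs).1 = n + (Bs.map fun B => pos B.1 B.1).sum := by
  induction Bs generalizing n with
  | nil => simp [encodeBDDs]
  | cons B Bs ih => rw [encodeBDDs, ih]; simp [Nat.add_assoc]

/-- **Support of the list encoding**: input variables or fresh variables in `[n, counter)`. [folklore] -/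
theorem mem_encodeBDDs {var : X → ℕ} {n : ℕ} {Bs : List (Σ s, BDD X s)} {q : List (List ℕ)}
    (hq : q ∈ (encodeBDDs var n Bs).2) {μ : List ℕ} (hμ : μ ∈ q) :
    μ.length ≤ 3 ∧ ∀ y ∈ μ, (∃ x, var x = y) ∨ (n ≤ y ∧ y < (encodeBDDs var n Bs).1) := by
  induction Bs generalizing n with
  | nil => simp [encodeBDDs] at hq
  | cons B Bs ih =>
    simp only [encodeBDDs, List.mem_append] at hq ⊢
    have hle := le_encodeBDDs_fst var (n + pos B.1 B.1) Bs
    rcases hq with hq | hq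
    · obtain ⟨hlen, hy⟩ := mem_encodeBDD hq hμ
      exact ⟨hlen, fun y hyμ => (hy y hyμ).imp id fun h => ⟨h.1, by omega⟩⟩
    · obtain ⟨hlen, hy⟩ := ih hq
      exact ⟨hlen, fun y hyμ => (hy y hyμ).imp id fun h => ⟨by omega, h.2⟩⟩

/-- **The list encoding is a perfect extension of the list of computed bits.**
[cite: ApplebaumIshaiKushilevitz2006, Lemma 4.9 and Lemma 4.15] -/
theorem perfExt_encodeBDDs {var : X → ℕ} {n : ℕ} (hvar : ∀ x, var x < n) (Bs : List (Σ s, BDD X s)) :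
    PerfExt n (encodeBDDs var n Bs).1 (encodeBDDs var n Bs).2
      (fun v => Bs.map fun B => B.2.fn (inputOf var v)) := by
  induction Bs generalizing n with
  | nil => exact perfExt_nil (fun v w => rfl) n
  | cons B Bs ih =>
    have h₁ := perfExt_encodeBDD (n₀ := n) B.2 hvar
    have h₂ := ih (n := n + pos B.1 B.1) (fun x => Nat.lt_add_right _ (hvar x))
    have happ := PerfExt.append (Nat.le_add_right _ _)
      (fun v w hvw => by simp only [inputOf_congr hvar hvw]) h₁ h₂
      (fun q hq μ hμ y hy => by
        rcases (mem_encodeBDD hq hμ).2 y hy with ⟨x, rfl⟩ | h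
        · exact Nat.lt_add_right _ (hvar x)
        · exact h.2)
      (fun q hq μ hμ y hy => by
        rcases (mem_encodeBDDs hq hμ).2 y hy with ⟨x, rfl⟩ | h
        · exact Or.inl (hvar x)
        · exact Or.inr h.1)
    refine happ.congr_target fun v w => ?_
    simp only [List.map_cons, List.cons.injEq, Prod.mk.injEq]

end RandPoly

end Literature.Computability.Complexity
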